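/-
Copyright (c) 2026. All rights reserved.
Released under Apache 2.0 license as described in the file LICENSE.
Authors: HodgeCM publication cell (pub-hodgecm), model-construction sub-cell, construction prover `mc-unitary-2`.
-/
import Literature.NumberTheory.Automorphic.UnitaryGroupSeesawConjugation
import Literature.NumberTheory.Automorphic.UnitaryGroupDirectSumCarriers
import HarnessLib

/-!
# The see-saw conjugation square read on `W = W₁ ⊕ W₂`: inverse forms and the block-diagonal squares
`e ∘ (Λ_C⁻¹ (h₀⁻¹ · ι_{V,W}(v ⊗ g (u₁ ⊕ u₂) g⁻¹) · h₀) Λ_C) ∘ e⁻¹ = ι_{V,W₁}(v ⊗ u₁) ⊕ ι_{V,W₂}(v ⊗ u₂)`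

Topic `NumberTheory/Automorphic`; namespace `Literature.NumberTheory.Automorphic.UnitaryGroup` (seventh part of
`UnitaryGroupSymplecticEmbedding`; the junction of `UnitaryGroupSeesawConjugation` with `UnitaryGroupDirectSum` /
`UnitaryGroupDirectSumCarriers`). Definitions and proved lemmas only: **no named facts, 0 proof holes**.

**Setting.** As in `UnitaryGroupSeesawConjugation`: quadratic coordinates `h : IsQuadraticCoordinates φ Ψ δ d`, the
conjugation `σ`, `R`-rational Gram matrices, and for an ISOMETRY `g` with `(σ g)ᵀ H g = H′` and a RELABELLING
`C` with `T C = T′` the element `h₀ = seesawConj g C = Res(g) ∘ Λ_C⁻¹ ∈ Sp(W_T)` and the square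
`h₀ · (Λ_C ι′(u′) Λ_C⁻¹) · h₀⁻¹ = ι(g u′ g⁻¹)` (`UnitaryGroupSeesawConjugation` §3, §4, §6).  This file adds:

* §1 `symplecticGroupCongr θ⁻¹ ∘ symplecticGroupCongr θ = id` (`symplecticGroupCongr` of
  `UnitaryGroupSymplecticCarriers` §7 is a `MonoidHom`, so the inverse transport is `symplecticGroupCongr θ.symm`) and
  the abstract INVERSE FORM of a conjugation square, `k (θ x′ θ⁻¹) k⁻¹ = x ⟹ θ⁻¹ (k⁻¹ x k) θ = x′`, with its
  uniqueness clause (`symplecticGroupCongr θ` is injective);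
* §2 the inverse forms of the see-saw squares — **`Λ_C⁻¹ (h₀⁻¹ · ι(g u′ g⁻¹) · h₀) Λ_C = ι′(u′)`** for `toSymplectic`
  and, with the named element **`pairSeesawConj = seesawConj (1_V ⊗ g) C ∈ Sp(W_{T_V ⊗ T_W})`**, for `pairToSymplectic`
  (this is the direction in which a splitting over `U(V) × U(W)` is READ on `U(V) × U(W′)`);
* §3 the specialisation `W′ = W₁ ⊕ W₂` read in a basis adapted to the sum — index `m₁ ⊕ m₂`, Gram matrix
  `fromBlocks T₁ 0 0 T₂`, `u′ = u₁ ⊕ u₂ = blockDiag σ H₁ H₂ (u₁, u₂)` (`UnitaryGroupDirectSum` §3) — CHAINED with the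
  see-saw identity `e ∘ ι_{V,W₁ ⊕ W₂}(v ⊗ (u₁ ⊕ u₂)) ∘ e⁻¹ = ι_{V,W₁}(v ⊗ u₁) ⊕ ι_{V,W₂}(v ⊗ u₂)`
  (`UnitaryGroupDirectSum.IsQuadraticCoordinates.pairToSymplectic_dualPair_blockDiag`, `e = Equiv.prodSumDistrib`): as
  an identity of linear automorphisms of `R^{(n × m₁) ⊕ (n × m₂)} × R^{(n × m₁) ⊕ (n × m₂)}`,
  **`spReindex e (Λ_C⁻¹ (h₀⁻¹ · ι_{V,W}(v ⊗ g (u₁ ⊕ u₂) g⁻¹) · h₀) Λ_C) = spSum (ι_{V,W₁}(v ⊗ u₁), ι_{V,W₂}(v ⊗ u₂))`**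
  (closed form `spReindex_pairSeesawConj_inv_conj_blockDiag`, hypothesis form `spReindex_eq_spSum_of_pairSeesawConj_conj_eq`:
  ANY `x ∈ Sp(W_{T_V ⊗ (T₁ ⊕ T₂)})` with `h₀ (Λ_C x Λ_C⁻¹) h₀⁻¹ = ι_{V,W}(v ⊗ g (u₁ ⊕ u₂) g⁻¹)` satisfies it) — the
  Gram matrices are `T_V ⊗ fromBlocks T₁ 0 0 T₂` and `fromBlocks (T_V ⊗ T₁) 0 0 (T_V ⊗ T₂)`, the shape of
  `Weil1964/AdelicMetaplecticSeesawKronecker` on instantiation `R := 𝔸_F`;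
* §3𝔸 that instantiation spelled out — `R := 𝔸_F`, `S := 𝔸_E` (`isQuadraticCoordinates_adele`), `σ := conjAdele c`,
  generic index types, Gram matrices literally adelic — with the compatibilities `σ ∘ φ = φ`, `σ δ = -δ` discharged
  (`conjAdele_baseChange_and_delta`): the forward square **`adele_pairSeesawConj_conj_blockDiag`** (`hsq`) and the
  block-diagonal reading **`adele_spReindex_pairToSymplectic_dualPair_blockDiag`** (`hbd`), whose common map
  `ι_{V,W₁⊕W₂}(v ⊗ (u₁ ⊕ u₂))` is syntactically one term, and the `F`-rationality of `h₀ = pairSeesawConj (g₀ ⊗ 1) (C₀ ⊗ 1)`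
  (**`adele_pairSeesawConj_mem_range`**, the hypothesis of Weil's `Θ`-fixing rational lift);
* §4 the same over the adeles of a CM extension in the `Fin`-indexed vocabulary of `UnitaryGroupAutomorphicRep.adelic`
  / `UnitaryGroupDirectSumCarriers` (`W′ = W₁ ⊕ W₂` carried by `Fin (M₁ + M₂)`, Gram `finSum T₁ T₂ = T₁ ⊕ᶠ T₂`,
  `u′ = adelicBlockDiag (u₁, u₂)`, `e = finProdSumEquiv`): **`adelicSeesawConj_inv_conj`**,
  **`adelicSeesawConj_conj_adelicBlockDiag`**, **`spReindex_adelicSeesawConj_inv_conj_adelicBlockDiag`**,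
  **`spReindex_eq_spSum_of_adelicSeesawConj_conj_eq`**, and the rationality of `h₀` for `T_W′ = T₁ ⊕ᶠ T₂`
  (`adelicSeesawConj_finSum_mem_range`, a specialisation of `adelicSeesawConj_mem_range`).

Context: the see-saw of unitary dual pairs `(U(V) × U(V), U(W₁) × U(W₂)) ↔ (U(V), U(W₁ ⊕ W₂))` [Kudla1984, §1],
[GelbartRogawski1991, §3.2], in the coordinates of [MoeglinVignerasWaldspurger1987, Ch. 1 I.17–I.19].  Everything
here is group algebra over the proved squares of the two imported files; kernel only; `[folklore]` unless tagged.

## Mathlib / tree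

Mathlib: `mul_assoc`, `inv_mul_cancel`, `inv_mul_cancel_right`, `mul_left_cancel`, `mul_right_cancel`,
`LinearEquiv.symm_apply_apply / apply_symm_apply`.
Tree: `UnitaryGroupSeesawConjugation` (`relabelEquiv`, `polar_relabelEquiv(_symm)`, `isometryConj`, `seesawConj`,
`seesawConj_conj_toSymplectic`, `seesawConj_conj_pairToSymplectic`, `kroneckerGL_one_isometry`, `seesawConj_adele_mem_range`,
`adelicIsometryConj`, `adelicSeesawConj`, `adelicSeesawConj_conj`, `adelicSeesawConj_mem_range`), `UnitaryGroupSymplecticRationalPoints`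
(`SpTransport.isUnit_det_kronecker`), `UnitaryGroupSymplecticCarriers`
(`symplecticGroupCongr`, `coe_symplecticGroupCongr_apply`, `symplecticGroupCongr_injective`), `UnitaryGroupDirectSum`
(`blockDiag`, `spReindex`, `spSum`, `isSymm_fromBlocks_diag`, `fromBlocks_diag_map`,
`IsQuadraticCoordinates.pairToSymplectic_dualPair_blockDiag`), `QuadraticRestrictionOfScalars`
(`isQuadraticCoordinates_adele`), `UnitaryGroupAutomorphicRep` / `ClassFieldCharacter` (`conjAdele`, `conjAdele_apply`,
`algebraMap_conj`, `AdeleRing.baseChange`, `AdeleRing.smul_baseChange`), `UnitaryGroupDirectSumCarriers` (`finSum`,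
`finProdSumEquiv`, `adelicBlockDiag`, `adelicPairToSymplectic_dualPair_adelicBlockDiag`), `UnitaryGroupDualPairCarriers`
(`pairToSymplectic`, `adelicPairToSymplectic`).

## Elaboration note

In the two hypothesis-form lemmas the Gram matrix of the bound variable `x` and the right-hand side of `hC` carry the
type ascription `(… : Matrix _ _ R)`: a Kronecker product `A ⊗ₖ B = kroneckerMap (· * ·) A B` written inside a
binder leaves the instance of `(· * ·)` pending until the end of the statement, and unifying two such pending copies
(the type of `x` against the domain of `symplecticGroupCongr Λ_C`) otherwise times out in `whnf`.  The ascriptions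
change nothing in the elaborated statement; a consumer whose `x` is the value of a homomorphism (e.g. `π(S′ p)`) is
not affected.

## Provenance

Written under the LEAN-IN-TREE rule (2026-08-18) for the pub-hodgecm formalisation cell (model-construction sub-cell,
node W2-⊗ «(34)-TRANSPORT», consumer-side leaf (o1), ruling (SS′)).  Nothing in this file is a claim of the manuscripts
adjudicated by that cell; every property is proved in the kernel.

## References

* S. Kudla, Seesaw dual reductive pairs, Progr. Math. 46 (1984) 244–268, §1 [Kudla1984].
* C. Mœglin, M.-F. Vignéras, J.-L. Waldspurger, *Correspondances de Howe sur un corps p-adique*, LNM 1291 (1987),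
  Ch. 1 [MoeglinVignerasWaldspurger1987].
* S. Gelbart, J. Rogawski, L-functions and Fourier–Jacobi coefficients for the unitary group U(3), Invent. Math. 105
  (1991), §3 [GelbartRogawski1991].
-/

set_option autoImplicit false

noncomputable section

open Matrix NumberField
open scoped Kronecker
open Literature.RepresentationTheory.HeisenbergGroup

namespace Literature.NumberTheory.Automorphic

namespace UnitaryGroup

variable {R S : Type*} [CommRing R] [CommRing S]

/-! ## 1. `symplecticGroupCongr θ⁻¹` inverts `symplecticGroupCongr θ`; the inverse form of a conjugation square -/

section CongrSymm

variable {V V' : Type*} [AddCommGroup V] [Module R V] [AddCommGroup V'] [Module R V']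

/-- `θ⁻¹ (θ x θ⁻¹) θ = x`: `symplecticGroupCongr θ.symm` is a left inverse of `symplecticGroupCongr θ`. [folklore] -/
@[simp] theorem symplecticGroupCongr_symm_congr (B : V →ₗ[R] V →ₗ[R] R) (B' : V' →ₗ[R] V' →ₗ[R] R)
    (θ : V ≃ₗ[R] V') (hθ : ∀ v w, B' (θ v) (θ w) = B v w) (hθ' : ∀ v w, B (θ.symm v) (θ.symm w) = B' v w)
    (x : symplecticGroup B) :
    symplecticGroupCongr B' B θ.symm hθ' (symplecticGroupCongr B B' θ hθ x) = x :=
  Subtype.ext (LinearEquiv.ext fun v => by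
    simp only [coe_symplecticGroupCongr_apply, LinearEquiv.symm_symm, LinearEquiv.symm_apply_apply])

/-- `θ (θ⁻¹ x′ θ) θ⁻¹ = x′`: … and a right inverse. [folklore] -/
@[simp] theorem symplecticGroupCongr_congr_symm (B : V →ₗ[R] V →ₗ[R] R) (B' : V' →ₗ[R] V' →ₗ[R] R)
    (θ : V ≃ₗ[R] V') (hθ : ∀ v w, B' (θ v) (θ w) = B v w) (hθ' : ∀ v w, B (θ.symm v) (θ.symm w) = B' v w)
    (x' : symplecticGroup B') :
    symplecticGroupCongr B B' θ hθ (symplecticGroupCongr B' B θ.symm hθ' x') = x' :=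
  Subtype.ext (LinearEquiv.ext fun v => by
    simp only [coe_symplecticGroupCongr_apply, LinearEquiv.symm_symm, LinearEquiv.apply_symm_apply])

/-- **Inverse form of a conjugation square**: from `k · (θ x′ θ⁻¹) · k⁻¹ = x` conclude `θ⁻¹ (k⁻¹ · x · k) θ = x′`.
[folklore] -/
theorem symplecticGroupCongr_symm_inv_mul_mul_of_conj_eq (B : V →ₗ[R] V →ₗ[R] R) (B' : V' →ₗ[R] V' →ₗ[R] R)
    (θ : V ≃ₗ[R] V') (hθ : ∀ v w, B' (θ v) (θ w) = B v w) (hθ' : ∀ v w, B (θ.symm v) (θ.symm w) = B' v w)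
    {k x : symplecticGroup B'} {x' : symplecticGroup B} (hsq : k * symplecticGroupCongr B B' θ hθ x' * k⁻¹ = x) :
    symplecticGroupCongr B' B θ.symm hθ' (k⁻¹ * x * k) = x' := by
  rw [← hsq]
  simp only [← mul_assoc, inv_mul_cancel, one_mul, inv_mul_cancel_right, symplecticGroupCongr_symm_congr]

/-- **Uniqueness in a conjugation square**: `k · (θ x θ⁻¹) · k⁻¹ = k · (θ x′ θ⁻¹) · k⁻¹` forces `x = x′`
(`symplecticGroupCongr θ` is injective). [folklore] -/
theorem eq_of_conj_symplecticGroupCongr_eq (B : V →ₗ[R] V →ₗ[R] R) (B' : V' →ₗ[R] V' →ₗ[R] R) (θ : V ≃ₗ[R] V')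
    (hθ : ∀ v w, B' (θ v) (θ w) = B v w) (k : symplecticGroup B') {x x' : symplecticGroup B}
    (hxx' : k * symplecticGroupCongr B B' θ hθ x * k⁻¹ = k * symplecticGroupCongr B B' θ hθ x' * k⁻¹) : x = x' :=
  symplecticGroupCongr_injective B B' θ hθ (mul_left_cancel (mul_right_cancel hxx'))

end CongrSymm

/-! ## 2. Inverse forms of the see-saw squares; the named element `pairSeesawConj = seesawConj (1_V ⊗ g) C` -/

namespace IsQuadraticCoordinates

variable {φ : R →+* S} {Ψ : (R × R) ≃+ S} {δ : S} {d : R} (h : IsQuadraticCoordinates φ Ψ δ d)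
variable (n : Type*) [Fintype n] [DecidableEq n]

/-- **INVERSE FORM OF THE SEE-SAW SQUARE**: `Λ_C⁻¹ (h₀⁻¹ · ι(g u′ g⁻¹) · h₀) Λ_C = ι′(u′)` for `u′ ∈ U(σ, H′)`,
`h₀ = seesawConj g C`, `ι = toSymplectic … hH`, `ι′ = toSymplectic … hH′`. [cite: Kudla1984, §1] -/
theorem seesawConj_inv_conj_toSymplectic {T T' : Matrix n n R} (hT : T.IsSymm) (hT' : T'.IsSymm) {σ : S →+* S}
    (hσφ : ∀ a, σ (φ a) = φ a) (hσδ : σ δ = -δ) {H H' : Matrix n n S} (hH : H = T.map φ) (hH' : H' = T'.map φ)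
    (g : GL n S) (hg : ((g : Matrix n n S).map σ)ᵀ * H * g = H') (C : GL n R) (hC : T * (C : Matrix n n R) = T')
    (u : unitaryGroupOfForm σ H') :
    symplecticGroupCongr _ _ (relabelEquiv C).symm (polar_relabelEquiv_symm T C hC)
        ((h.seesawConj n hT hT' hσφ hσδ hH hH' g hg C hC)⁻¹ * h.toSymplectic n hT hσφ hσδ hH (isometryConj σ g hg u) *
          h.seesawConj n hT hT' hσφ hσδ hH hH' g hg C hC) =
      h.toSymplectic n hT' hσφ hσδ hH' u :=
  symplecticGroupCongr_symm_inv_mul_mul_of_conj_eq _ _ _ _ _ (h.seesawConj_conj_toSymplectic n hT hT' hσφ hσδ hH hH'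
    g hg C hC u)

end IsQuadraticCoordinates

section Kronecker

variable {n m : Type*} [Fintype n] [Fintype m] [DecidableEq n] [DecidableEq m]
variable {φ : R →+* S} {Ψ : (R × R) ≃+ S} {δ : S} {d : R}

/-- **`pairSeesawConj = seesawConj (1_V ⊗ g) C ∈ Sp(W_{T_V ⊗ T_W})`** — the see-saw conjugation element of the dual
pair `U(σ, H_V) × U(σ, H_W)` for an isometry `g : (Sᵐ, H_W′) ≅ (Sᵐ, H_W)` and `C ∈ GL_{n × m}(R)` with
`(T_V ⊗ T_W) C = T_V ⊗ T_W′` (a NAME for the element of `UnitaryGroupSeesawConjugation` §4; an element of the same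
symplectic group as the images of `pairToSymplectic hV hW …`). [cite: Kudla1984, §1] -/
abbrev IsQuadraticCoordinates.pairSeesawConj (h : IsQuadraticCoordinates φ Ψ δ d) {TV : Matrix n n R}
    {TW TW' : Matrix m m R} (hV : TV.IsSymm) (hW : TW.IsSymm) (hW' : TW'.IsSymm) {σ : S →+* S}
    (hσφ : ∀ a, σ (φ a) = φ a) (hσδ : σ δ = -δ) {HV : Matrix n n S} {HW HW' : Matrix m m S} (hHV : HV = TV.map φ)
    (hHW : HW = TW.map φ) (hHW' : HW' = TW'.map φ) (g : GL m S) (hg : ((g : Matrix m m S).map σ)ᵀ * HW * g = HW')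
    (C : GL (n × m) R) (hC : TV ⊗ₖ TW * (C : Matrix (n × m) (n × m) R) = TV ⊗ₖ TW') :
    symplecticGroup (polar (Matrix.toLinearMap₂' R (TV ⊗ₖ TW))) :=
  h.seesawConj (n × m) (isSymm_kronecker hV hW) (isSymm_kronecker hV hW') hσφ hσδ
    (show HV ⊗ₖ HW = (TV ⊗ₖ TW).map φ by rw [hHV, hHW, kronecker_map_map])
    (show HV ⊗ₖ HW' = (TV ⊗ₖ TW').map φ by rw [hHV, hHW', kronecker_map_map])
    (kroneckerGL ((1 : GL n S), g)) (kroneckerGL_one_isometry σ HV g hg) C hC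

/-- **The see-saw square for the dual pair** in terms of `pairSeesawConj`:
`h₀ · (Λ_C ι′(v ⊗ u′) Λ_C⁻¹) · h₀⁻¹ = ι(v ⊗ g u′ g⁻¹)` (`UnitaryGroupSeesawConjugation.seesawConj_conj_pairToSymplectic`).
[cite: Kudla1984, §1] -/
theorem IsQuadraticCoordinates.pairSeesawConj_conj (h : IsQuadraticCoordinates φ Ψ δ d) {TV : Matrix n n R}
    {TW TW' : Matrix m m R} (hV : TV.IsSymm) (hW : TW.IsSymm) (hW' : TW'.IsSymm) {σ : S →+* S}
    (hσφ : ∀ a, σ (φ a) = φ a) (hσδ : σ δ = -δ) {HV : Matrix n n S} {HW HW' : Matrix m m S} (hHV : HV = TV.map φ)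
    (hHW : HW = TW.map φ) (hHW' : HW' = TW'.map φ) (g : GL m S) (hg : ((g : Matrix m m S).map σ)ᵀ * HW * g = HW')
    (C : GL (n × m) R) (hC : TV ⊗ₖ TW * (C : Matrix (n × m) (n × m) R) = TV ⊗ₖ TW')
    (v : unitaryGroupOfForm σ HV) (u : unitaryGroupOfForm σ HW') :
    h.pairSeesawConj hV hW hW' hσφ hσδ hHV hHW hHW' g hg C hC *
        symplecticGroupCongr _ _ (relabelEquiv C) (polar_relabelEquiv _ C hC)
          (h.pairToSymplectic hV hW' hσφ hσδ hHV hHW' (dualPair σ HV HW' (v, u))) *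
      (h.pairSeesawConj hV hW hW' hσφ hσδ hHV hHW hHW' g hg C hC)⁻¹ =
    h.pairToSymplectic hV hW hσφ hσδ hHV hHW (dualPair σ HV HW (v, isometryConj σ g hg u)) :=
  h.seesawConj_conj_pairToSymplectic hV hW hW' hσφ hσδ hHV hHW hHW' g hg C hC v u

/-- **INVERSE FORM OF THE SEE-SAW SQUARE FOR THE DUAL PAIR**: `Λ_C⁻¹ (h₀⁻¹ · ι(v ⊗ g u′ g⁻¹) · h₀) Λ_C = ι′(v ⊗ u′)`,
`h₀ = pairSeesawConj`, `ι = pairToSymplectic … hHW`, `ι′ = pairToSymplectic … hHW′` — how an embedding of the pair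
`U(σ, H_V) × U(σ, H_W)` is READ on `U(σ, H_V) × U(σ, H_W′)` through the isometry `g`. [cite: Kudla1984, §1] -/
theorem IsQuadraticCoordinates.pairSeesawConj_inv_conj (h : IsQuadraticCoordinates φ Ψ δ d) {TV : Matrix n n R}
    {TW TW' : Matrix m m R} (hV : TV.IsSymm) (hW : TW.IsSymm) (hW' : TW'.IsSymm) {σ : S →+* S}
    (hσφ : ∀ a, σ (φ a) = φ a) (hσδ : σ δ = -δ) {HV : Matrix n n S} {HW HW' : Matrix m m S} (hHV : HV = TV.map φ)
    (hHW : HW = TW.map φ) (hHW' : HW' = TW'.map φ) (g : GL m S) (hg : ((g : Matrix m m S).map σ)ᵀ * HW * g = HW')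
    (C : GL (n × m) R) (hC : TV ⊗ₖ TW * (C : Matrix (n × m) (n × m) R) = TV ⊗ₖ TW')
    (v : unitaryGroupOfForm σ HV) (u : unitaryGroupOfForm σ HW') :
    symplecticGroupCongr _ _ (relabelEquiv C).symm (polar_relabelEquiv_symm _ C hC)
        ((h.pairSeesawConj hV hW hW' hσφ hσδ hHV hHW hHW' g hg C hC)⁻¹ *
            h.pairToSymplectic hV hW hσφ hσδ hHV hHW (dualPair σ HV HW (v, isometryConj σ g hg u)) *
          h.pairSeesawConj hV hW hW' hσφ hσδ hHV hHW hHW' g hg C hC) =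
      h.pairToSymplectic hV hW' hσφ hσδ hHV hHW' (dualPair σ HV HW' (v, u)) :=
  symplecticGroupCongr_symm_inv_mul_mul_of_conj_eq _ _ _ _ _
    (h.seesawConj_conj_pairToSymplectic hV hW hW' hσφ hσδ hHV hHW hHW' g hg C hC v u)

end Kronecker

/-! ## 3. `W′ = W₁ ⊕ W₂`: the block-diagonal squares (index `m₁ ⊕ m₂`, Gram `fromBlocks T₁ 0 0 T₂`) -/

section BlockDiag

variable {n m₁ m₂ : Type*} [Fintype n] [Fintype m₁] [Fintype m₂] [DecidableEq n] [DecidableEq m₁] [DecidableEq m₂]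
variable {φ : R →+* S} {Ψ : (R × R) ≃+ S} {δ : S} {d : R}

omit [Fintype m₁] [Fintype m₂] [DecidableEq m₁] [DecidableEq m₂] in
/-- `fromBlocks H₁ 0 0 H₂ = (fromBlocks T₁ 0 0 T₂) ⊗ 1` for `H_j = T_j ⊗ 1`. [folklore] -/
theorem fromBlocks_diag_eq_map {T₁ : Matrix m₁ m₁ R} {T₂ : Matrix m₂ m₂ R} {H₁ : Matrix m₁ m₁ S}
    {H₂ : Matrix m₂ m₂ S} (hH₁ : H₁ = T₁.map φ) (hH₂ : H₂ = T₂.map φ) :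
    Matrix.fromBlocks H₁ 0 0 H₂ = (Matrix.fromBlocks T₁ 0 0 T₂).map φ := by
  rw [hH₁, hH₂, fromBlocks_diag_map]

/-- **THE SEE-SAW SQUARE ON `W = W₁ ⊕ W₂`**: for an isometry `g : (S^{m₁ ⊕ m₂}, H₁ ⊕ H₂) ≅ (S^{m₁ ⊕ m₂}, H_W)`
(`(σ g)ᵀ H_W g = fromBlocks H₁ 0 0 H₂`), `(T_V ⊗ T_W) C = T_V ⊗ (T₁ ⊕ T₂)`, `v ∈ U(σ, H_V)`, `u_j ∈ U(σ, H_j)`: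
`h₀ · (Λ_C ι_{V,W₁ ⊕ W₂}(v ⊗ (u₁ ⊕ u₂)) Λ_C⁻¹) · h₀⁻¹ = ι_{V,W}(v ⊗ g (u₁ ⊕ u₂) g⁻¹)`, `u₁ ⊕ u₂ = blockDiag σ H₁ H₂ (u₁, u₂)`.
[cite: Kudla1984, §1] -/
theorem IsQuadraticCoordinates.pairSeesawConj_conj_blockDiag (h : IsQuadraticCoordinates φ Ψ δ d)
    {TV : Matrix n n R} {TW : Matrix (m₁ ⊕ m₂) (m₁ ⊕ m₂) R} {T₁ : Matrix m₁ m₁ R} {T₂ : Matrix m₂ m₂ R}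
    (hV : TV.IsSymm) (hW : TW.IsSymm) (h₁ : T₁.IsSymm) (h₂ : T₂.IsSymm) {σ : S →+* S} (hσφ : ∀ a, σ (φ a) = φ a)
    (hσδ : σ δ = -δ) {HV : Matrix n n S} {HW : Matrix (m₁ ⊕ m₂) (m₁ ⊕ m₂) S} {H₁ : Matrix m₁ m₁ S}
    {H₂ : Matrix m₂ m₂ S} (hHV : HV = TV.map φ) (hHW : HW = TW.map φ) (hH₁ : H₁ = T₁.map φ) (hH₂ : H₂ = T₂.map φ)
    (g : GL (m₁ ⊕ m₂) S) (hg : ((g : Matrix (m₁ ⊕ m₂) (m₁ ⊕ m₂) S).map σ)ᵀ * HW * g = Matrix.fromBlocks H₁ 0 0 H₂)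
    (C : GL (n × (m₁ ⊕ m₂)) R)
    (hC : TV ⊗ₖ TW * (C : Matrix (n × (m₁ ⊕ m₂)) (n × (m₁ ⊕ m₂)) R) = TV ⊗ₖ Matrix.fromBlocks T₁ 0 0 T₂)
    (v : unitaryGroupOfForm σ HV) (u : unitaryGroupOfForm σ H₁ × unitaryGroupOfForm σ H₂) :
    h.pairSeesawConj hV hW (isSymm_fromBlocks_diag h₁ h₂) hσφ hσδ hHV hHW (fromBlocks_diag_eq_map hH₁ hH₂) g hg C hC *
        symplecticGroupCongr _ _ (relabelEquiv C) (polar_relabelEquiv _ C hC)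
          (h.pairToSymplectic hV (isSymm_fromBlocks_diag h₁ h₂) hσφ hσδ hHV (fromBlocks_diag_eq_map hH₁ hH₂)
            (dualPair σ HV (Matrix.fromBlocks H₁ 0 0 H₂) (v, blockDiag σ H₁ H₂ u))) *
      (h.pairSeesawConj hV hW (isSymm_fromBlocks_diag h₁ h₂) hσφ hσδ hHV hHW (fromBlocks_diag_eq_map hH₁ hH₂)
          g hg C hC)⁻¹ =
    h.pairToSymplectic hV hW hσφ hσδ hHV hHW (dualPair σ HV HW (v, isometryConj σ g hg (blockDiag σ H₁ H₂ u))) :=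
  h.pairSeesawConj_conj hV hW _ hσφ hσδ hHV hHW _ g hg C hC v _

/-- **THE (34)-TRANSPORT READ ON `ι_{V,W₁} ⊕ ι_{V,W₂}` (closed form).** With `e = Equiv.prodSumDistrib n m₁ m₂`:
`spReindex e (Λ_C⁻¹ (h₀⁻¹ · ι_{V,W}(v ⊗ g (u₁ ⊕ u₂) g⁻¹) · h₀) Λ_C) = spSum (ι_{V,W₁}(v ⊗ u₁), ι_{V,W₂}(v ⊗ u₂))`
as linear automorphisms of `R^{(n × m₁) ⊕ (n × m₂)} × R^{(n × m₁) ⊕ (n × m₂)}` (the two symplectic groups have the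
Gram matrices `reindex e e (T_V ⊗ fromBlocks T₁ 0 0 T₂)` and `fromBlocks (T_V ⊗ T₁) 0 0 (T_V ⊗ T₂)`, equal by
`UnitaryGroupDirectSum.reindex_kronecker_fromBlocks_diag`): the inverse square (§2) chained with
`UnitaryGroupDirectSum.IsQuadraticCoordinates.pairToSymplectic_dualPair_blockDiag`. [cite: Kudla1984, §1] -/
theorem IsQuadraticCoordinates.spReindex_pairSeesawConj_inv_conj_blockDiag (h : IsQuadraticCoordinates φ Ψ δ d)
    {TV : Matrix n n R} {TW : Matrix (m₁ ⊕ m₂) (m₁ ⊕ m₂) R} {T₁ : Matrix m₁ m₁ R} {T₂ : Matrix m₂ m₂ R}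
    (hV : TV.IsSymm) (hW : TW.IsSymm) (h₁ : T₁.IsSymm) (h₂ : T₂.IsSymm) {σ : S →+* S} (hσφ : ∀ a, σ (φ a) = φ a)
    (hσδ : σ δ = -δ) {HV : Matrix n n S} {HW : Matrix (m₁ ⊕ m₂) (m₁ ⊕ m₂) S} {H₁ : Matrix m₁ m₁ S}
    {H₂ : Matrix m₂ m₂ S} (hHV : HV = TV.map φ) (hHW : HW = TW.map φ) (hH₁ : H₁ = T₁.map φ) (hH₂ : H₂ = T₂.map φ)
    (g : GL (m₁ ⊕ m₂) S) (hg : ((g : Matrix (m₁ ⊕ m₂) (m₁ ⊕ m₂) S).map σ)ᵀ * HW * g = Matrix.fromBlocks H₁ 0 0 H₂)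
    (C : GL (n × (m₁ ⊕ m₂)) R)
    (hC : TV ⊗ₖ TW * (C : Matrix (n × (m₁ ⊕ m₂)) (n × (m₁ ⊕ m₂)) R) = TV ⊗ₖ Matrix.fromBlocks T₁ 0 0 T₂)
    (v : unitaryGroupOfForm σ HV) (u : unitaryGroupOfForm σ H₁ × unitaryGroupOfForm σ H₂) :
    ((spReindex (Equiv.prodSumDistrib n m₁ m₂) (TV ⊗ₖ Matrix.fromBlocks T₁ 0 0 T₂)
          (symplecticGroupCongr _ _ (relabelEquiv C).symm (polar_relabelEquiv_symm _ C hC)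
            ((h.pairSeesawConj hV hW (isSymm_fromBlocks_diag h₁ h₂) hσφ hσδ hHV hHW (fromBlocks_diag_eq_map hH₁ hH₂)
                  g hg C hC)⁻¹ *
                h.pairToSymplectic hV hW hσφ hσδ hHV hHW
                  (dualPair σ HV HW (v, isometryConj σ g hg (blockDiag σ H₁ H₂ u))) *
              h.pairSeesawConj hV hW (isSymm_fromBlocks_diag h₁ h₂) hσφ hσδ hHV hHW (fromBlocks_diag_eq_map hH₁ hH₂)
                g hg C hC)) :
        symplecticGroup (polar (Matrix.toLinearMap₂' R
          (Matrix.reindex (Equiv.prodSumDistrib n m₁ m₂) (Equiv.prodSumDistrib n m₁ m₂)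
            (TV ⊗ₖ Matrix.fromBlocks T₁ 0 0 T₂))))) :
        (((n × m₁) ⊕ (n × m₂) → R) × ((n × m₁) ⊕ (n × m₂) → R)) ≃ₗ[R]
          (((n × m₁) ⊕ (n × m₂) → R) × ((n × m₁) ⊕ (n × m₂) → R))) =
      ((spSum (TV ⊗ₖ T₁) (TV ⊗ₖ T₂)
          (h.pairToSymplectic hV h₁ hσφ hσδ hHV hH₁ (dualPair σ HV H₁ (v, u.1)),
            h.pairToSymplectic hV h₂ hσφ hσδ hHV hH₂ (dualPair σ HV H₂ (v, u.2))) :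
        symplecticGroup (polar (Matrix.toLinearMap₂' R (Matrix.fromBlocks (TV ⊗ₖ T₁) 0 0 (TV ⊗ₖ T₂))))) :
        (((n × m₁) ⊕ (n × m₂) → R) × ((n × m₁) ⊕ (n × m₂) → R)) ≃ₗ[R]
          (((n × m₁) ⊕ (n × m₂) → R) × ((n × m₁) ⊕ (n × m₂) → R))) := by
  rw [h.pairSeesawConj_inv_conj hV hW _ hσφ hσδ hHV hHW _ g hg C hC v _]
  exact h.pairToSymplectic_dualPair_blockDiag hV h₁ h₂ hσφ hσδ hHV hH₁ hH₂ v u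

/-- **THE (34)-TRANSPORT READ ON `ι_{V,W₁} ⊕ ι_{V,W₂}` (hypothesis form).** ANY `x ∈ Sp(W_{T_V ⊗ (T₁ ⊕ T₂)})` with
`h₀ · (Λ_C x Λ_C⁻¹) · h₀⁻¹ = ι_{V,W}(v ⊗ g (u₁ ⊕ u₂) g⁻¹)` satisfies
`spReindex e x = spSum (ι_{V,W₁}(v ⊗ u₁), ι_{V,W₂}(v ⊗ u₂))` as linear automorphisms (`x` is then
`ι_{V,W₁ ⊕ W₂}(v ⊗ (u₁ ⊕ u₂))`, by injectivity of `Λ_C · Λ_C⁻¹` and of conjugation). [cite: Kudla1984, §1] -/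
theorem IsQuadraticCoordinates.spReindex_eq_spSum_of_pairSeesawConj_conj_eq (h : IsQuadraticCoordinates φ Ψ δ d)
    {TV : Matrix n n R} {TW : Matrix (m₁ ⊕ m₂) (m₁ ⊕ m₂) R} {T₁ : Matrix m₁ m₁ R} {T₂ : Matrix m₂ m₂ R}
    (hV : TV.IsSymm) (hW : TW.IsSymm) (h₁ : T₁.IsSymm) (h₂ : T₂.IsSymm) {σ : S →+* S} (hσφ : ∀ a, σ (φ a) = φ a)
    (hσδ : σ δ = -δ) {HV : Matrix n n S} {HW : Matrix (m₁ ⊕ m₂) (m₁ ⊕ m₂) S} {H₁ : Matrix m₁ m₁ S}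
    {H₂ : Matrix m₂ m₂ S} (hHV : HV = TV.map φ) (hHW : HW = TW.map φ) (hH₁ : H₁ = T₁.map φ) (hH₂ : H₂ = T₂.map φ)
    (g : GL (m₁ ⊕ m₂) S) (hg : ((g : Matrix (m₁ ⊕ m₂) (m₁ ⊕ m₂) S).map σ)ᵀ * HW * g = Matrix.fromBlocks H₁ 0 0 H₂)
    (C : GL (n × (m₁ ⊕ m₂)) R)
    (hC : TV ⊗ₖ TW * (C : Matrix (n × (m₁ ⊕ m₂)) (n × (m₁ ⊕ m₂)) R) =
      (TV ⊗ₖ Matrix.fromBlocks T₁ 0 0 T₂ : Matrix (n × (m₁ ⊕ m₂)) (n × (m₁ ⊕ m₂)) R))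
    (v : unitaryGroupOfForm σ HV) (u : unitaryGroupOfForm σ H₁ × unitaryGroupOfForm σ H₂)
    {x : symplecticGroup (polar (Matrix.toLinearMap₂' R
      (TV ⊗ₖ Matrix.fromBlocks T₁ 0 0 T₂ : Matrix (n × (m₁ ⊕ m₂)) (n × (m₁ ⊕ m₂)) R)))}
    (hx : h.pairSeesawConj hV hW (isSymm_fromBlocks_diag h₁ h₂) hσφ hσδ hHV hHW (fromBlocks_diag_eq_map hH₁ hH₂)
          g hg C hC * symplecticGroupCongr _ _ (relabelEquiv C) (polar_relabelEquiv (TV ⊗ₖ TW) C hC) x *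
        (h.pairSeesawConj hV hW (isSymm_fromBlocks_diag h₁ h₂) hσφ hσδ hHV hHW (fromBlocks_diag_eq_map hH₁ hH₂)
          g hg C hC)⁻¹ =
      h.pairToSymplectic hV hW hσφ hσδ hHV hHW (dualPair σ HV HW (v, isometryConj σ g hg (blockDiag σ H₁ H₂ u)))) :
    ((spReindex (Equiv.prodSumDistrib n m₁ m₂) (TV ⊗ₖ Matrix.fromBlocks T₁ 0 0 T₂) x :
        symplecticGroup (polar (Matrix.toLinearMap₂' R
          (Matrix.reindex (Equiv.prodSumDistrib n m₁ m₂) (Equiv.prodSumDistrib n m₁ m₂)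
            (TV ⊗ₖ Matrix.fromBlocks T₁ 0 0 T₂))))) :
        (((n × m₁) ⊕ (n × m₂) → R) × ((n × m₁) ⊕ (n × m₂) → R)) ≃ₗ[R]
          (((n × m₁) ⊕ (n × m₂) → R) × ((n × m₁) ⊕ (n × m₂) → R))) =
      ((spSum (TV ⊗ₖ T₁) (TV ⊗ₖ T₂)
          (h.pairToSymplectic hV h₁ hσφ hσδ hHV hH₁ (dualPair σ HV H₁ (v, u.1)),
            h.pairToSymplectic hV h₂ hσφ hσδ hHV hH₂ (dualPair σ HV H₂ (v, u.2))) :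
        symplecticGroup (polar (Matrix.toLinearMap₂' R (Matrix.fromBlocks (TV ⊗ₖ T₁) 0 0 (TV ⊗ₖ T₂))))) :
        (((n × m₁) ⊕ (n × m₂) → R) × ((n × m₁) ⊕ (n × m₂) → R)) ≃ₗ[R]
          (((n × m₁) ⊕ (n × m₂) → R) × ((n × m₁) ⊕ (n × m₂) → R))) := by
  rw [eq_of_conj_symplecticGroupCongr_eq _ _ _ _ _
    (hx.trans (h.pairSeesawConj_conj_blockDiag hV hW h₁ h₂ hσφ hσδ hHV hHW hH₁ hH₂ g hg C hC v u).symm)]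
  exact h.pairToSymplectic_dualPair_blockDiag hV h₁ h₂ hσφ hσδ hHV hH₁ hH₂ v u

end BlockDiag

/-! ## §3𝔸  The adele instance with generic index types (the currency of #12 / #13)

`R := 𝔸_F`, `S := 𝔸_E = 𝔸_F ⊕ 𝔸_F δ` (`isQuadraticCoordinates_adele`), `σ := conjAdele c`, Gram matrices LITERALLY
adelic (`T_V : Matrix n n 𝔸_F`, …; a consumer holding `F`-rational Grams instantiates `T_V := T_V⁰.map ι_𝔸`), index
types `n`, `m₁ ⊕ m₂` generic.  The two hypotheses of the metaplectic half of the (34)-transport — the forward see-saw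
square `hsq` and the block-diagonal reading `hbd` — are the theorems `adele_pairSeesawConj_conj_blockDiag` and
`adele_spReindex_pairToSymplectic_dualPair_blockDiag` below, with the quadratic-coordinates compatibilities of `σ`
(`σ ∘ φ = φ`, `σ δ = -δ`) discharged once (`conjAdele_baseChange_and_delta`), so that the map `ι'` occurring in
both is syntactically one term. -/

section AdeleBlockDiag

variable (F E : Type) [Field F] [NumberField F] [Field E] [NumberField E] [Algebra F E] (c : E ≃ₐ[F] E)
variable {n m₁ m₂ : Type*} [Fintype n] [Fintype m₁] [Fintype m₂] [DecidableEq n] [DecidableEq m₁] [DecidableEq m₂]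

/-- The Galois conjugation `σ = conjAdele c` of `𝔸_E` fixes `𝔸_F ⊆ 𝔸_E` pointwise and negates `δ` (`c δ = -δ`): the two
compatibilities required by the quadratic-coordinates carrier maps, packaged as one conjunction. [folklore] -/
theorem conjAdele_baseChange_and_delta {δ : E} (hcδ : c δ = -δ) :
    (∀ a, conjAdele F E c (AdeleRing.baseChange F E a) = AdeleRing.baseChange F E a) ∧
      conjAdele F E c (algebraMap E (AdeleRing (𝓞 E) E) δ) = -algebraMap E (AdeleRing (𝓞 E) E) δ :=
  ⟨fun a => by rw [conjAdele_apply, AdeleRing.smul_baseChange],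
    by rw [← algebraMap_conj, RingHom.coe_coe, hcδ, map_neg]⟩

/-- **THE ADELIC SEE-SAW SQUARE ON `U(V) × (U(W₁) × U(W₂))`, generic indices** (`hsq`): for `g ∈ GL(W)(𝔸_E)` with
`ᵗḡ H_W g = H₁ ⊕ H₂`, `C` with `(T_V ⊗ T_W) C = T_V ⊗ (T₁ ⊕ T₂)` and `h₀ = pairSeesawConj g C`:
`h₀ · Λ_C ι_{V,W₁⊕W₂}(v ⊗ (u₁ ⊕ u₂)) Λ_C⁻¹ · h₀⁻¹ = ι_{V,W}(v ⊗ g (u₁ ⊕ u₂) g⁻¹)` in `Sp(W_{T_V ⊗ T_W})(𝔸_F)` — §3 at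
the adele instance of quadratic coordinates. [cite: Kudla1984, §1] -/
theorem adele_pairSeesawConj_conj_blockDiag [Algebra.IsQuadraticExtension F E] {δ : E} (hcδ : c δ = -δ)
    (hδ : δ ≠ 0) {d : F} (hd : δ * δ = algebraMap F E d) {TV : Matrix n n (AdeleRing (𝓞 F) F)}
    {TW : Matrix (m₁ ⊕ m₂) (m₁ ⊕ m₂) (AdeleRing (𝓞 F) F)} {T₁ : Matrix m₁ m₁ (AdeleRing (𝓞 F) F)}
    {T₂ : Matrix m₂ m₂ (AdeleRing (𝓞 F) F)} (hV : TV.IsSymm) (hW : TW.IsSymm) (h₁ : T₁.IsSymm) (h₂ : T₂.IsSymm)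
    {HV : Matrix n n (AdeleRing (𝓞 E) E)} {HW : Matrix (m₁ ⊕ m₂) (m₁ ⊕ m₂) (AdeleRing (𝓞 E) E)}
    {H₁ : Matrix m₁ m₁ (AdeleRing (𝓞 E) E)} {H₂ : Matrix m₂ m₂ (AdeleRing (𝓞 E) E)}
    (hHV : HV = TV.map (AdeleRing.baseChange F E)) (hHW : HW = TW.map (AdeleRing.baseChange F E))
    (hH₁ : H₁ = T₁.map (AdeleRing.baseChange F E)) (hH₂ : H₂ = T₂.map (AdeleRing.baseChange F E))
    (g : GL (m₁ ⊕ m₂) (AdeleRing (𝓞 E) E))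
    (hg : ((g : Matrix (m₁ ⊕ m₂) (m₁ ⊕ m₂) (AdeleRing (𝓞 E) E)).map (conjAdele F E c))ᵀ * HW * g =
      Matrix.fromBlocks H₁ 0 0 H₂)
    (C : GL (n × (m₁ ⊕ m₂)) (AdeleRing (𝓞 F) F))
    (hC : TV ⊗ₖ TW * (C : Matrix (n × (m₁ ⊕ m₂)) (n × (m₁ ⊕ m₂)) (AdeleRing (𝓞 F) F)) =
      TV ⊗ₖ Matrix.fromBlocks T₁ 0 0 T₂)
    (v : unitaryGroupOfForm (conjAdele F E c) HV)
    (u : unitaryGroupOfForm (conjAdele F E c) H₁ × unitaryGroupOfForm (conjAdele F E c) H₂) :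
    (isQuadraticCoordinates_adele E c hcδ hδ hd).pairSeesawConj hV hW (isSymm_fromBlocks_diag h₁ h₂)
          (conjAdele_baseChange_and_delta F E c hcδ).1 (conjAdele_baseChange_and_delta F E c hcδ).2 hHV hHW
          (fromBlocks_diag_eq_map hH₁ hH₂) g hg C hC *
        symplecticGroupCongr _ _ (relabelEquiv C) (polar_relabelEquiv _ C hC)
          ((isQuadraticCoordinates_adele E c hcδ hδ hd).pairToSymplectic hV (isSymm_fromBlocks_diag h₁ h₂)
            (conjAdele_baseChange_and_delta F E c hcδ).1 (conjAdele_baseChange_and_delta F E c hcδ).2 hHV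
            (fromBlocks_diag_eq_map hH₁ hH₂)
            (dualPair (conjAdele F E c) HV (Matrix.fromBlocks H₁ 0 0 H₂) (v, blockDiag (conjAdele F E c) H₁ H₂ u))) *
      ((isQuadraticCoordinates_adele E c hcδ hδ hd).pairSeesawConj hV hW (isSymm_fromBlocks_diag h₁ h₂)
          (conjAdele_baseChange_and_delta F E c hcδ).1 (conjAdele_baseChange_and_delta F E c hcδ).2 hHV hHW
          (fromBlocks_diag_eq_map hH₁ hH₂) g hg C hC)⁻¹ =
    (isQuadraticCoordinates_adele E c hcδ hδ hd).pairToSymplectic hV hW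
      (conjAdele_baseChange_and_delta F E c hcδ).1 (conjAdele_baseChange_and_delta F E c hcδ).2 hHV hHW
      (dualPair (conjAdele F E c) HV HW (v, isometryConj (conjAdele F E c) g hg (blockDiag (conjAdele F E c) H₁ H₂ u))) :=
  (isQuadraticCoordinates_adele E c hcδ hδ hd).pairSeesawConj_conj_blockDiag hV hW h₁ h₂ _ _ hHV hHW hH₁ hH₂ g hg C hC
    v u

/-- **THE BLOCK-DIAGONAL READING, adele instance, generic indices** (`hbd`): with `e = Equiv.prodSumDistrib n m₁ m₂`,
`spReindex e (ι_{V,W₁⊕W₂}(v ⊗ (u₁ ⊕ u₂))) = spSum (ι_{V,W₁}(v ⊗ u₁), ι_{V,W₂}(v ⊗ u₂))` as linear automorphisms of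
`𝔸_F^{(n × m₁) ⊕ (n × m₂)} × 𝔸_F^{(n × m₁) ⊕ (n × m₂)}` — `UnitaryGroupDirectSum.IsQuadraticCoordinates.pairToSymplectic_dualPair_blockDiag`
at the adele instance, with the map `ι_{V,W₁⊕W₂}(v ⊗ (u₁ ⊕ u₂))` syntactically the one of
`adele_pairSeesawConj_conj_blockDiag`. [folklore] -/
theorem adele_spReindex_pairToSymplectic_dualPair_blockDiag [Algebra.IsQuadraticExtension F E] {δ : E}
    (hcδ : c δ = -δ) (hδ : δ ≠ 0) {d : F} (hd : δ * δ = algebraMap F E d) {TV : Matrix n n (AdeleRing (𝓞 F) F)}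
    {T₁ : Matrix m₁ m₁ (AdeleRing (𝓞 F) F)} {T₂ : Matrix m₂ m₂ (AdeleRing (𝓞 F) F)} (hV : TV.IsSymm)
    (h₁ : T₁.IsSymm) (h₂ : T₂.IsSymm) {HV : Matrix n n (AdeleRing (𝓞 E) E)} {H₁ : Matrix m₁ m₁ (AdeleRing (𝓞 E) E)}
    {H₂ : Matrix m₂ m₂ (AdeleRing (𝓞 E) E)} (hHV : HV = TV.map (AdeleRing.baseChange F E))
    (hH₁ : H₁ = T₁.map (AdeleRing.baseChange F E)) (hH₂ : H₂ = T₂.map (AdeleRing.baseChange F E))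
    (v : unitaryGroupOfForm (conjAdele F E c) HV)
    (u : unitaryGroupOfForm (conjAdele F E c) H₁ × unitaryGroupOfForm (conjAdele F E c) H₂) :
    ((spReindex (Equiv.prodSumDistrib n m₁ m₂) (TV ⊗ₖ Matrix.fromBlocks T₁ 0 0 T₂)
          ((isQuadraticCoordinates_adele E c hcδ hδ hd).pairToSymplectic hV (isSymm_fromBlocks_diag h₁ h₂)
            (conjAdele_baseChange_and_delta F E c hcδ).1 (conjAdele_baseChange_and_delta F E c hcδ).2 hHV
            (fromBlocks_diag_eq_map hH₁ hH₂)
            (dualPair (conjAdele F E c) HV (Matrix.fromBlocks H₁ 0 0 H₂) (v, blockDiag (conjAdele F E c) H₁ H₂ u))) :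
        symplecticGroup (polar (Matrix.toLinearMap₂' (AdeleRing (𝓞 F) F)
          (Matrix.reindex (Equiv.prodSumDistrib n m₁ m₂) (Equiv.prodSumDistrib n m₁ m₂)
            (TV ⊗ₖ Matrix.fromBlocks T₁ 0 0 T₂))))) :
        (((n × m₁) ⊕ (n × m₂) → AdeleRing (𝓞 F) F) × ((n × m₁) ⊕ (n × m₂) → AdeleRing (𝓞 F) F)) ≃ₗ[AdeleRing (𝓞 F) F]
          (((n × m₁) ⊕ (n × m₂) → AdeleRing (𝓞 F) F) × ((n × m₁) ⊕ (n × m₂) → AdeleRing (𝓞 F) F))) =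
      ((spSum (TV ⊗ₖ T₁) (TV ⊗ₖ T₂)
          ((isQuadraticCoordinates_adele E c hcδ hδ hd).pairToSymplectic hV h₁
              (conjAdele_baseChange_and_delta F E c hcδ).1 (conjAdele_baseChange_and_delta F E c hcδ).2 hHV hH₁
              (dualPair (conjAdele F E c) HV H₁ (v, u.1)),
            (isQuadraticCoordinates_adele E c hcδ hδ hd).pairToSymplectic hV h₂
              (conjAdele_baseChange_and_delta F E c hcδ).1 (conjAdele_baseChange_and_delta F E c hcδ).2 hHV hH₂
              (dualPair (conjAdele F E c) HV H₂ (v, u.2))) :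
        symplecticGroup (polar (Matrix.toLinearMap₂' (AdeleRing (𝓞 F) F)
          (Matrix.fromBlocks (TV ⊗ₖ T₁) 0 0 (TV ⊗ₖ T₂))))) :
        (((n × m₁) ⊕ (n × m₂) → AdeleRing (𝓞 F) F) × ((n × m₁) ⊕ (n × m₂) → AdeleRing (𝓞 F) F)) ≃ₗ[AdeleRing (𝓞 F) F]
          (((n × m₁) ⊕ (n × m₂) → AdeleRing (𝓞 F) F) × ((n × m₁) ⊕ (n × m₂) → AdeleRing (𝓞 F) F))) :=
  (isQuadraticCoordinates_adele E c hcδ hδ hd).pairToSymplectic_dualPair_blockDiag hV h₁ h₂ _ _ hHV hH₁ hH₂ v u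

/-- **`h₀ = pairSeesawConj (g₀ ⊗ 1) (C₀ ⊗ 1)` OF RATIONAL DATA IS `F`-RATIONAL, adele instance, generic indices**:
for `F`-rational Grams `T_V = T_V⁰ ⊗ 1`, `T_W = T_W⁰ ⊗ 1`, `T_j = T_j⁰ ⊗ 1` (`det T_V⁰, det T_W⁰` units), an isometry
`g = g₀ ⊗ 1` (`g₀ ∈ GL(W)(E)`) and a relabelling `C = C₀ ⊗ 1` (`C₀ ∈ GL_{n × (m₁ ⊕ m₂)}(F)`),
`pairSeesawConj g C ∈ ((transportSp (T_V ⊗ T_W) hT).comp (mapHom ι)).range`, `ι = algebraMap F 𝔸_F` — the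
`F`-rational points of `Sp(𝕎)(𝔸_F)` of record (cf. [GelbartRogawski1991, §3.1 p. 455]), i.e. the hypothesis of
Weil's `Θ`-fixing rational lift [Weil1964, Chap. III n° 41 Thm 6 p. 193]; `UnitaryGroupSeesawConjugation.seesawConj_adele_mem_range`
at `ι := n × (m₁ ⊕ m₂)`, `g := 1 ⊗ g`. [folklore] -/
theorem adele_pairSeesawConj_mem_range [Algebra.IsQuadraticExtension F E] {δ : E} (hcδ : c δ = -δ) (hδ : δ ≠ 0)
    {d : F} (hd : δ * δ = algebraMap F E d) {TV₀ : Matrix n n F} {TW₀ : Matrix (m₁ ⊕ m₂) (m₁ ⊕ m₂) F}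
    {T₁₀ : Matrix m₁ m₁ F} {T₂₀ : Matrix m₂ m₂ F} (hV₀ : TV₀.IsSymm) (hW₀ : TW₀.IsSymm) (h₁₀ : T₁₀.IsSymm)
    (h₂₀ : T₂₀.IsSymm) (hTV₀d : IsUnit TV₀.det) (hTW₀d : IsUnit TW₀.det) {TV : Matrix n n (AdeleRing (𝓞 F) F)}
    {TW : Matrix (m₁ ⊕ m₂) (m₁ ⊕ m₂) (AdeleRing (𝓞 F) F)} {T₁ : Matrix m₁ m₁ (AdeleRing (𝓞 F) F)}
    {T₂ : Matrix m₂ m₂ (AdeleRing (𝓞 F) F)} (hTV : TV = TV₀.map (algebraMap F (AdeleRing (𝓞 F) F)))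
    (hTW : TW = TW₀.map (algebraMap F (AdeleRing (𝓞 F) F))) (hT₁ : T₁ = T₁₀.map (algebraMap F (AdeleRing (𝓞 F) F)))
    (hT₂ : T₂ = T₂₀.map (algebraMap F (AdeleRing (𝓞 F) F))) (hV : TV.IsSymm) (hW : TW.IsSymm) (h₁ : T₁.IsSymm)
    (h₂ : T₂.IsSymm) (hT : IsUnit (TV ⊗ₖ TW).det) {HV : Matrix n n (AdeleRing (𝓞 E) E)}
    {HW : Matrix (m₁ ⊕ m₂) (m₁ ⊕ m₂) (AdeleRing (𝓞 E) E)} {H₁ : Matrix m₁ m₁ (AdeleRing (𝓞 E) E)}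
    {H₂ : Matrix m₂ m₂ (AdeleRing (𝓞 E) E)} (hHV : HV = TV.map (AdeleRing.baseChange F E))
    (hHW : HW = TW.map (AdeleRing.baseChange F E)) (hH₁ : H₁ = T₁.map (AdeleRing.baseChange F E))
    (hH₂ : H₂ = T₂.map (AdeleRing.baseChange F E)) {g : GL (m₁ ⊕ m₂) (AdeleRing (𝓞 E) E)} {g₀ : GL (m₁ ⊕ m₂) E}
    (hgg₀ : (g : Matrix (m₁ ⊕ m₂) (m₁ ⊕ m₂) (AdeleRing (𝓞 E) E)) =
      ((g₀ : GL (m₁ ⊕ m₂) E) : Matrix (m₁ ⊕ m₂) (m₁ ⊕ m₂) E).map (algebraMap E (AdeleRing (𝓞 E) E)))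
    (hg : ((g : Matrix (m₁ ⊕ m₂) (m₁ ⊕ m₂) (AdeleRing (𝓞 E) E)).map (conjAdele F E c))ᵀ * HW * g =
      Matrix.fromBlocks H₁ 0 0 H₂)
    {C : GL (n × (m₁ ⊕ m₂)) (AdeleRing (𝓞 F) F)} {C₀ : GL (n × (m₁ ⊕ m₂)) F}
    (hCC₀ : (C : Matrix (n × (m₁ ⊕ m₂)) (n × (m₁ ⊕ m₂)) (AdeleRing (𝓞 F) F)) =
      ((C₀ : GL (n × (m₁ ⊕ m₂)) F) : Matrix (n × (m₁ ⊕ m₂)) (n × (m₁ ⊕ m₂)) F).map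
        (algebraMap F (AdeleRing (𝓞 F) F)))
    (hC : TV ⊗ₖ TW * (C : Matrix (n × (m₁ ⊕ m₂)) (n × (m₁ ⊕ m₂)) (AdeleRing (𝓞 F) F)) =
      TV ⊗ₖ Matrix.fromBlocks T₁ 0 0 T₂) :
    (isQuadraticCoordinates_adele E c hcδ hδ hd).pairSeesawConj hV hW (isSymm_fromBlocks_diag h₁ h₂)
        (conjAdele_baseChange_and_delta F E c hcδ).1 (conjAdele_baseChange_and_delta F E c hcδ).2 hHV hHW
        (fromBlocks_diag_eq_map hH₁ hH₂) g hg C hC ∈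
      ((SymplecticMatrix.transportSp (TV ⊗ₖ TW) hT).comp
        (SymplecticMatrix.mapHom (algebraMap F (AdeleRing (𝓞 F) F)))).range :=
  seesawConj_adele_mem_range F E c hcδ hδ hd (isSymm_kronecker hV₀ hW₀)
    (isSymm_kronecker hV₀ (isSymm_fromBlocks_diag h₁₀ h₂₀)) (SpTransport.isUnit_det_kronecker hTV₀d hTW₀d)
    (by rw [hTV, hTW, kronecker_map_map]) (by rw [hTV, hT₁, hT₂, ← fromBlocks_diag_map, kronecker_map_map]) _ _ hT
    _ _ (g₀ := kroneckerGL ((1 : GL n E), g₀))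
    (by
      show ((1 : GL n (AdeleRing (𝓞 E) E)) : Matrix n n (AdeleRing (𝓞 E) E)) ⊗ₖ
          (g : Matrix (m₁ ⊕ m₂) (m₁ ⊕ m₂) (AdeleRing (𝓞 E) E)) =
        (((1 : GL n E) : Matrix n n E) ⊗ₖ ((g₀ : GL (m₁ ⊕ m₂) E) : Matrix (m₁ ⊕ m₂) (m₁ ⊕ m₂) E)).map
          (algebraMap E (AdeleRing (𝓞 E) E))
      rw [Units.val_one, Units.val_one, hgg₀, ← Matrix.map_one (algebraMap E (AdeleRing (𝓞 E) E)) (map_zero _)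
        (map_one _), kronecker_map_map])
    _ hCC₀ hC

end AdeleBlockDiag

/-! ## 4. Number fields, `Fin`-indexed carriers: `W′ = W₁ ⊕ W₂` on `Fin (M₁ + M₂)`, Gram `T₁ ⊕ᶠ T₂` -/

section DualPairAdelic

variable (F E : Type) [Field F] [NumberField F] [Field E] [NumberField E] [Algebra F E] (c : E ≃ₐ[F] E) (N M : ℕ)

/-- **INVERSE FORM OF THE ADELIC SEE-SAW SQUARE**: `Λ_C⁻¹ (h₀⁻¹ · toSp(v ⊗ g u′ g⁻¹) · h₀) Λ_C = toSp′(v ⊗ u′)` for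
`v ∈ U(J_V)(𝔸_F)`, `u′ ∈ U(J_W′)(𝔸_F)`, `h₀ = adelicSeesawConj g C`, `toSp = adelicPairToSymplectic … hJW`,
`toSp′ = adelicPairToSymplectic … hJW′`. [cite: Kudla1984, §1] -/
theorem adelicSeesawConj_inv_conj [Algebra.IsQuadraticExtension F E] {δ : E} (hcδ : c δ = -δ) (hδ : δ ≠ 0) {d : F}
    (hd : δ * δ = algebraMap F E d) {TV : Matrix (Fin N) (Fin N) F} {TW TW' : Matrix (Fin M) (Fin M) F}
    (hV : TV.IsSymm) (hW : TW.IsSymm) (hW' : TW'.IsSymm) {JV : Matrix (Fin N) (Fin N) E}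
    {JW JW' : Matrix (Fin M) (Fin M) E} (hJV : JV = TV.map (algebraMap F E)) (hJW : JW = TW.map (algebraMap F E))
    (hJW' : JW' = TW'.map (algebraMap F E)) (g : GL (Fin M) (AdeleRing (𝓞 E) E))
    (hg : ((g : Matrix (Fin M) (Fin M) (AdeleRing (𝓞 E) E)).map (conjAdele F E c))ᵀ * adelicForm E M JW * g =
      adelicForm E M JW') (C : GL (Fin N × Fin M) (AdeleRing (𝓞 F) F))
    (hC : TV.map (algebraMap F (AdeleRing (𝓞 F) F)) ⊗ₖ TW.map (algebraMap F (AdeleRing (𝓞 F) F)) *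
        (C : Matrix (Fin N × Fin M) (Fin N × Fin M) (AdeleRing (𝓞 F) F)) =
      TV.map (algebraMap F (AdeleRing (𝓞 F) F)) ⊗ₖ TW'.map (algebraMap F (AdeleRing (𝓞 F) F)))
    (v : adelic F E c N JV) (u : adelic F E c M JW') :
    symplecticGroupCongr _ _ (relabelEquiv C).symm (polar_relabelEquiv_symm _ C hC)
        ((adelicSeesawConj F E c N M hcδ hδ hd hV hW hW' hJV hJW hJW' g hg C hC)⁻¹ *
            adelicPairToSymplectic F E c N M hcδ hδ hd hV hW hJV hJW
              (dualPair (conjAdele F E c) (adelicForm E N JV) (adelicForm E M JW)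
                (v, adelicIsometryConj F E c M g hg u)) *
          adelicSeesawConj F E c N M hcδ hδ hd hV hW hW' hJV hJW hJW' g hg C hC) =
      adelicPairToSymplectic F E c N M hcδ hδ hd hV hW' hJV hJW'
        (dualPair (conjAdele F E c) (adelicForm E N JV) (adelicForm E M JW') (v, u)) :=
  symplecticGroupCongr_symm_inv_mul_mul_of_conj_eq _ _ _ _ _
    (adelicSeesawConj_conj F E c N M hcδ hδ hd hV hW hW' hJV hJW hJW' g hg C hC v u)

variable {M} (M₁ M₂ : ℕ)

omit [NumberField F] [NumberField E] in
/-- `J₁ ⊕ᶠ J₂ = (T₁ ⊕ᶠ T₂).map (algebraMap F E)` for `J_j = T_j ⊗ 1`. [folklore] -/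
theorem finSum_eq_map {T₁ : Matrix (Fin M₁) (Fin M₁) F} {T₂ : Matrix (Fin M₂) (Fin M₂) F}
    {J₁ : Matrix (Fin M₁) (Fin M₁) E} {J₂ : Matrix (Fin M₂) (Fin M₂) E} (hJ₁ : J₁ = T₁.map (algebraMap F E))
    (hJ₂ : J₂ = T₂.map (algebraMap F E)) :
    finSum M₁ M₂ J₁ J₂ = (finSum M₁ M₂ T₁ T₂).map (algebraMap F E) := by
  rw [hJ₁, hJ₂, finSum_map]

/-- **THE ADELIC SEE-SAW SQUARE ON `W = W₁ ⊕ W₂`** (`W ⊗ 𝔸` carried by `Fin (M₁ + M₂)`, `J_W′ = J₁ ⊕ᶠ J₂`,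
`T_W′ = T₁ ⊕ᶠ T₂`): for an adelic isometry `g` with `(c g)ᵀ (J_W ⊗ 1) g = (J₁ ⊕ᶠ J₂) ⊗ 1`,
`(T_V ⊗ T_W ⊗ 1) C = T_V ⊗ (T₁ ⊕ᶠ T₂) ⊗ 1`, `v ∈ U(J_V)(𝔸_F)`, `u_j ∈ U(J_j)(𝔸_F)`:
`h₀ · (Λ_C toSp_{V,W₁ ⊕ W₂}(v ⊗ (u₁ ⊕ᶠ u₂)) Λ_C⁻¹) · h₀⁻¹ = toSp_{V,W}(v ⊗ g (u₁ ⊕ᶠ u₂) g⁻¹)`,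
`u₁ ⊕ᶠ u₂ = adelicBlockDiag (u₁, u₂)`. [cite: Kudla1984, §1] -/
theorem adelicSeesawConj_conj_adelicBlockDiag [Algebra.IsQuadraticExtension F E] {δ : E} (hcδ : c δ = -δ)
    (hδ : δ ≠ 0) {d : F} (hd : δ * δ = algebraMap F E d) {TV : Matrix (Fin N) (Fin N) F}
    {TW : Matrix (Fin (M₁ + M₂)) (Fin (M₁ + M₂)) F} {T₁ : Matrix (Fin M₁) (Fin M₁) F}
    {T₂ : Matrix (Fin M₂) (Fin M₂) F} (hV : TV.IsSymm) (hW : TW.IsSymm) (h₁ : T₁.IsSymm) (h₂ : T₂.IsSymm)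
    {JV : Matrix (Fin N) (Fin N) E} {JW : Matrix (Fin (M₁ + M₂)) (Fin (M₁ + M₂)) E}
    {J₁ : Matrix (Fin M₁) (Fin M₁) E} {J₂ : Matrix (Fin M₂) (Fin M₂) E} (hJV : JV = TV.map (algebraMap F E))
    (hJW : JW = TW.map (algebraMap F E)) (hJ₁ : J₁ = T₁.map (algebraMap F E)) (hJ₂ : J₂ = T₂.map (algebraMap F E))
    (g : GL (Fin (M₁ + M₂)) (AdeleRing (𝓞 E) E))
    (hg : ((g : Matrix (Fin (M₁ + M₂)) (Fin (M₁ + M₂)) (AdeleRing (𝓞 E) E)).map (conjAdele F E c))ᵀ *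
        adelicForm E (M₁ + M₂) JW * g = adelicForm E (M₁ + M₂) (finSum M₁ M₂ J₁ J₂))
    (C : GL (Fin N × Fin (M₁ + M₂)) (AdeleRing (𝓞 F) F))
    (hC : TV.map (algebraMap F (AdeleRing (𝓞 F) F)) ⊗ₖ TW.map (algebraMap F (AdeleRing (𝓞 F) F)) *
        (C : Matrix (Fin N × Fin (M₁ + M₂)) (Fin N × Fin (M₁ + M₂)) (AdeleRing (𝓞 F) F)) =
      TV.map (algebraMap F (AdeleRing (𝓞 F) F)) ⊗ₖ (finSum M₁ M₂ T₁ T₂).map (algebraMap F (AdeleRing (𝓞 F) F)))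
    (v : adelic F E c N JV) (u : adelic F E c M₁ J₁ × adelic F E c M₂ J₂) :
    adelicSeesawConj F E c N (M₁ + M₂) hcδ hδ hd hV hW (isSymm_finSum h₁ h₂) hJV hJW (finSum_eq_map F E M₁ M₂ hJ₁ hJ₂)
          g hg C hC *
        symplecticGroupCongr _ _ (relabelEquiv C) (polar_relabelEquiv _ C hC)
          (adelicPairToSymplectic F E c N (M₁ + M₂) hcδ hδ hd hV (isSymm_finSum h₁ h₂) hJV
            (finSum_eq_map F E M₁ M₂ hJ₁ hJ₂)
            (dualPair (conjAdele F E c) (adelicForm E N JV) (adelicForm E (M₁ + M₂) (finSum M₁ M₂ J₁ J₂))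
              (v, adelicBlockDiag F E c M₁ M₂ J₁ J₂ u))) *
      (adelicSeesawConj F E c N (M₁ + M₂) hcδ hδ hd hV hW (isSymm_finSum h₁ h₂) hJV hJW
          (finSum_eq_map F E M₁ M₂ hJ₁ hJ₂) g hg C hC)⁻¹ =
    adelicPairToSymplectic F E c N (M₁ + M₂) hcδ hδ hd hV hW hJV hJW
      (dualPair (conjAdele F E c) (adelicForm E N JV) (adelicForm E (M₁ + M₂) JW)
        (v, adelicIsometryConj F E c (M₁ + M₂) g hg (adelicBlockDiag F E c M₁ M₂ J₁ J₂ u))) :=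
  adelicSeesawConj_conj F E c N (M₁ + M₂) hcδ hδ hd hV hW _ hJV hJW _ g hg C hC v _

/-- **THE ADELIC (34)-TRANSPORT READ ON `toSp_{V,W₁} ⊕ toSp_{V,W₂}` (closed form).** With `e = finProdSumEquiv N M₁ M₂`:
`spReindex e (Λ_C⁻¹ (h₀⁻¹ · toSp_{V,W}(v ⊗ g (u₁ ⊕ᶠ u₂) g⁻¹) · h₀) Λ_C) = spSum (toSp_{V,W₁}(v ⊗ u₁), toSp_{V,W₂}(v ⊗ u₂))`
as linear automorphisms of `𝔸_F^{(N × M₁) ⊕ (N × M₂)} × 𝔸_F^{(N × M₁) ⊕ (N × M₂)}` (Gram matrices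
`reindex e e (T_V ⊗ (T₁ ⊕ᶠ T₂))` and `(T_V ⊗ T₁) ⊕ (T_V ⊗ T₂)` over `𝔸_F`, equal by
`UnitaryGroupDirectSumCarriers.reindex_kronecker_finSum`): `adelicSeesawConj_inv_conj` chained with
`UnitaryGroupDirectSumCarriers.adelicPairToSymplectic_dualPair_adelicBlockDiag`. [cite: Kudla1984, §1] -/
theorem spReindex_adelicSeesawConj_inv_conj_adelicBlockDiag [Algebra.IsQuadraticExtension F E] {δ : E}
    (hcδ : c δ = -δ) (hδ : δ ≠ 0) {d : F} (hd : δ * δ = algebraMap F E d) {TV : Matrix (Fin N) (Fin N) F}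
    {TW : Matrix (Fin (M₁ + M₂)) (Fin (M₁ + M₂)) F} {T₁ : Matrix (Fin M₁) (Fin M₁) F}
    {T₂ : Matrix (Fin M₂) (Fin M₂) F} (hV : TV.IsSymm) (hW : TW.IsSymm) (h₁ : T₁.IsSymm) (h₂ : T₂.IsSymm)
    {JV : Matrix (Fin N) (Fin N) E} {JW : Matrix (Fin (M₁ + M₂)) (Fin (M₁ + M₂)) E}
    {J₁ : Matrix (Fin M₁) (Fin M₁) E} {J₂ : Matrix (Fin M₂) (Fin M₂) E} (hJV : JV = TV.map (algebraMap F E))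
    (hJW : JW = TW.map (algebraMap F E)) (hJ₁ : J₁ = T₁.map (algebraMap F E)) (hJ₂ : J₂ = T₂.map (algebraMap F E))
    (g : GL (Fin (M₁ + M₂)) (AdeleRing (𝓞 E) E))
    (hg : ((g : Matrix (Fin (M₁ + M₂)) (Fin (M₁ + M₂)) (AdeleRing (𝓞 E) E)).map (conjAdele F E c))ᵀ *
        adelicForm E (M₁ + M₂) JW * g = adelicForm E (M₁ + M₂) (finSum M₁ M₂ J₁ J₂))
    (C : GL (Fin N × Fin (M₁ + M₂)) (AdeleRing (𝓞 F) F))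
    (hC : TV.map (algebraMap F (AdeleRing (𝓞 F) F)) ⊗ₖ TW.map (algebraMap F (AdeleRing (𝓞 F) F)) *
        (C : Matrix (Fin N × Fin (M₁ + M₂)) (Fin N × Fin (M₁ + M₂)) (AdeleRing (𝓞 F) F)) =
      TV.map (algebraMap F (AdeleRing (𝓞 F) F)) ⊗ₖ (finSum M₁ M₂ T₁ T₂).map (algebraMap F (AdeleRing (𝓞 F) F)))
    (v : adelic F E c N JV) (u : adelic F E c M₁ J₁ × adelic F E c M₂ J₂) :
    ((spReindex (finProdSumEquiv N M₁ M₂)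
          (TV.map (algebraMap F (AdeleRing (𝓞 F) F)) ⊗ₖ (finSum M₁ M₂ T₁ T₂).map (algebraMap F (AdeleRing (𝓞 F) F)))
          (symplecticGroupCongr _ _ (relabelEquiv C).symm (polar_relabelEquiv_symm _ C hC)
            ((adelicSeesawConj F E c N (M₁ + M₂) hcδ hδ hd hV hW (isSymm_finSum h₁ h₂) hJV hJW
                  (finSum_eq_map F E M₁ M₂ hJ₁ hJ₂) g hg C hC)⁻¹ *
                adelicPairToSymplectic F E c N (M₁ + M₂) hcδ hδ hd hV hW hJV hJW
                  (dualPair (conjAdele F E c) (adelicForm E N JV) (adelicForm E (M₁ + M₂) JW)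
                    (v, adelicIsometryConj F E c (M₁ + M₂) g hg (adelicBlockDiag F E c M₁ M₂ J₁ J₂ u))) *
              adelicSeesawConj F E c N (M₁ + M₂) hcδ hδ hd hV hW (isSymm_finSum h₁ h₂) hJV hJW
                (finSum_eq_map F E M₁ M₂ hJ₁ hJ₂) g hg C hC)) :
        symplecticGroup (polar (Matrix.toLinearMap₂' (AdeleRing (𝓞 F) F)
          (Matrix.reindex (finProdSumEquiv N M₁ M₂) (finProdSumEquiv N M₁ M₂)
            (TV.map (algebraMap F (AdeleRing (𝓞 F) F)) ⊗ₖ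
              (finSum M₁ M₂ T₁ T₂).map (algebraMap F (AdeleRing (𝓞 F) F))))))) :
        (((Fin N × Fin M₁) ⊕ (Fin N × Fin M₂) → AdeleRing (𝓞 F) F) ×
            ((Fin N × Fin M₁) ⊕ (Fin N × Fin M₂) → AdeleRing (𝓞 F) F)) ≃ₗ[AdeleRing (𝓞 F) F]
          (((Fin N × Fin M₁) ⊕ (Fin N × Fin M₂) → AdeleRing (𝓞 F) F) ×
            ((Fin N × Fin M₁) ⊕ (Fin N × Fin M₂) → AdeleRing (𝓞 F) F))) =
      ((spSum (TV.map (algebraMap F (AdeleRing (𝓞 F) F)) ⊗ₖ T₁.map (algebraMap F (AdeleRing (𝓞 F) F)))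
          (TV.map (algebraMap F (AdeleRing (𝓞 F) F)) ⊗ₖ T₂.map (algebraMap F (AdeleRing (𝓞 F) F)))
          (adelicPairToSymplectic F E c N M₁ hcδ hδ hd hV h₁ hJV hJ₁
              (dualPair (conjAdele F E c) (adelicForm E N JV) (adelicForm E M₁ J₁) (v, u.1)),
            adelicPairToSymplectic F E c N M₂ hcδ hδ hd hV h₂ hJV hJ₂
              (dualPair (conjAdele F E c) (adelicForm E N JV) (adelicForm E M₂ J₂) (v, u.2))) :
        symplecticGroup (polar (Matrix.toLinearMap₂' (AdeleRing (𝓞 F) F)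
          (Matrix.fromBlocks
            (TV.map (algebraMap F (AdeleRing (𝓞 F) F)) ⊗ₖ T₁.map (algebraMap F (AdeleRing (𝓞 F) F))) 0 0
            (TV.map (algebraMap F (AdeleRing (𝓞 F) F)) ⊗ₖ T₂.map (algebraMap F (AdeleRing (𝓞 F) F))))))) :
        (((Fin N × Fin M₁) ⊕ (Fin N × Fin M₂) → AdeleRing (𝓞 F) F) ×
            ((Fin N × Fin M₁) ⊕ (Fin N × Fin M₂) → AdeleRing (𝓞 F) F)) ≃ₗ[AdeleRing (𝓞 F) F]
          (((Fin N × Fin M₁) ⊕ (Fin N × Fin M₂) → AdeleRing (𝓞 F) F) ×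
            ((Fin N × Fin M₁) ⊕ (Fin N × Fin M₂) → AdeleRing (𝓞 F) F))) := by
  rw [adelicSeesawConj_inv_conj F E c N (M₁ + M₂) hcδ hδ hd hV hW _ hJV hJW _ g hg C hC v _]
  exact adelicPairToSymplectic_dualPair_adelicBlockDiag F E c N M₁ M₂ hcδ hδ hd hV h₁ h₂ hJV hJ₁ hJ₂ v u

/-- **THE ADELIC (34)-TRANSPORT READ ON `toSp_{V,W₁} ⊕ toSp_{V,W₂}` (hypothesis form).** ANY
`x ∈ Sp(𝕎_{T_V ⊗ (T₁ ⊕ᶠ T₂)})(𝔸_F)` with `h₀ · (Λ_C x Λ_C⁻¹) · h₀⁻¹ = toSp_{V,W}(v ⊗ g (u₁ ⊕ᶠ u₂) g⁻¹)` satisfies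
`spReindex e x = spSum (toSp_{V,W₁}(v ⊗ u₁), toSp_{V,W₂}(v ⊗ u₂))` as linear automorphisms — e.g. `x = π(S′(v, u₁, u₂))`
for a map `S′` into the metaplectic group read through the (34)-transport. [cite: Kudla1984, §1] -/
theorem spReindex_eq_spSum_of_adelicSeesawConj_conj_eq [Algebra.IsQuadraticExtension F E] {δ : E}
    (hcδ : c δ = -δ) (hδ : δ ≠ 0) {d : F} (hd : δ * δ = algebraMap F E d) {TV : Matrix (Fin N) (Fin N) F}
    {TW : Matrix (Fin (M₁ + M₂)) (Fin (M₁ + M₂)) F} {T₁ : Matrix (Fin M₁) (Fin M₁) F}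
    {T₂ : Matrix (Fin M₂) (Fin M₂) F} (hV : TV.IsSymm) (hW : TW.IsSymm) (h₁ : T₁.IsSymm) (h₂ : T₂.IsSymm)
    {JV : Matrix (Fin N) (Fin N) E} {JW : Matrix (Fin (M₁ + M₂)) (Fin (M₁ + M₂)) E}
    {J₁ : Matrix (Fin M₁) (Fin M₁) E} {J₂ : Matrix (Fin M₂) (Fin M₂) E} (hJV : JV = TV.map (algebraMap F E))
    (hJW : JW = TW.map (algebraMap F E)) (hJ₁ : J₁ = T₁.map (algebraMap F E)) (hJ₂ : J₂ = T₂.map (algebraMap F E))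
    (g : GL (Fin (M₁ + M₂)) (AdeleRing (𝓞 E) E))
    (hg : ((g : Matrix (Fin (M₁ + M₂)) (Fin (M₁ + M₂)) (AdeleRing (𝓞 E) E)).map (conjAdele F E c))ᵀ *
        adelicForm E (M₁ + M₂) JW * g = adelicForm E (M₁ + M₂) (finSum M₁ M₂ J₁ J₂))
    (C : GL (Fin N × Fin (M₁ + M₂)) (AdeleRing (𝓞 F) F))
    (hC : TV.map (algebraMap F (AdeleRing (𝓞 F) F)) ⊗ₖ TW.map (algebraMap F (AdeleRing (𝓞 F) F)) *
        (C : Matrix (Fin N × Fin (M₁ + M₂)) (Fin N × Fin (M₁ + M₂)) (AdeleRing (𝓞 F) F)) =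
      (TV.map (algebraMap F (AdeleRing (𝓞 F) F)) ⊗ₖ (finSum M₁ M₂ T₁ T₂).map (algebraMap F (AdeleRing (𝓞 F) F)) :
        Matrix (Fin N × Fin (M₁ + M₂)) (Fin N × Fin (M₁ + M₂)) (AdeleRing (𝓞 F) F)))
    (v : adelic F E c N JV) (u : adelic F E c M₁ J₁ × adelic F E c M₂ J₂)
    {x : symplecticGroup (polar (Matrix.toLinearMap₂' (AdeleRing (𝓞 F) F)
      (TV.map (algebraMap F (AdeleRing (𝓞 F) F)) ⊗ₖ (finSum M₁ M₂ T₁ T₂).map (algebraMap F (AdeleRing (𝓞 F) F)) :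
        Matrix (Fin N × Fin (M₁ + M₂)) (Fin N × Fin (M₁ + M₂)) (AdeleRing (𝓞 F) F))))}
    (hx : adelicSeesawConj F E c N (M₁ + M₂) hcδ hδ hd hV hW (isSymm_finSum h₁ h₂) hJV hJW
            (finSum_eq_map F E M₁ M₂ hJ₁ hJ₂) g hg C hC *
          symplecticGroupCongr _ _ (relabelEquiv C)
            (polar_relabelEquiv
              (TV.map (algebraMap F (AdeleRing (𝓞 F) F)) ⊗ₖ TW.map (algebraMap F (AdeleRing (𝓞 F) F))) C hC) x *
        (adelicSeesawConj F E c N (M₁ + M₂) hcδ hδ hd hV hW (isSymm_finSum h₁ h₂) hJV hJW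
            (finSum_eq_map F E M₁ M₂ hJ₁ hJ₂) g hg C hC)⁻¹ =
      adelicPairToSymplectic F E c N (M₁ + M₂) hcδ hδ hd hV hW hJV hJW
        (dualPair (conjAdele F E c) (adelicForm E N JV) (adelicForm E (M₁ + M₂) JW)
          (v, adelicIsometryConj F E c (M₁ + M₂) g hg (adelicBlockDiag F E c M₁ M₂ J₁ J₂ u)))) :
    ((spReindex (finProdSumEquiv N M₁ M₂)
          (TV.map (algebraMap F (AdeleRing (𝓞 F) F)) ⊗ₖ (finSum M₁ M₂ T₁ T₂).map (algebraMap F (AdeleRing (𝓞 F) F)))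
          x :
        symplecticGroup (polar (Matrix.toLinearMap₂' (AdeleRing (𝓞 F) F)
          (Matrix.reindex (finProdSumEquiv N M₁ M₂) (finProdSumEquiv N M₁ M₂)
            (TV.map (algebraMap F (AdeleRing (𝓞 F) F)) ⊗ₖ
              (finSum M₁ M₂ T₁ T₂).map (algebraMap F (AdeleRing (𝓞 F) F))))))) :
        (((Fin N × Fin M₁) ⊕ (Fin N × Fin M₂) → AdeleRing (𝓞 F) F) ×
            ((Fin N × Fin M₁) ⊕ (Fin N × Fin M₂) → AdeleRing (𝓞 F) F)) ≃ₗ[AdeleRing (𝓞 F) F]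
          (((Fin N × Fin M₁) ⊕ (Fin N × Fin M₂) → AdeleRing (𝓞 F) F) ×
            ((Fin N × Fin M₁) ⊕ (Fin N × Fin M₂) → AdeleRing (𝓞 F) F))) =
      ((spSum (TV.map (algebraMap F (AdeleRing (𝓞 F) F)) ⊗ₖ T₁.map (algebraMap F (AdeleRing (𝓞 F) F)))
          (TV.map (algebraMap F (AdeleRing (𝓞 F) F)) ⊗ₖ T₂.map (algebraMap F (AdeleRing (𝓞 F) F)))
          (adelicPairToSymplectic F E c N M₁ hcδ hδ hd hV h₁ hJV hJ₁
              (dualPair (conjAdele F E c) (adelicForm E N JV) (adelicForm E M₁ J₁) (v, u.1)),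
            adelicPairToSymplectic F E c N M₂ hcδ hδ hd hV h₂ hJV hJ₂
              (dualPair (conjAdele F E c) (adelicForm E N JV) (adelicForm E M₂ J₂) (v, u.2))) :
        symplecticGroup (polar (Matrix.toLinearMap₂' (AdeleRing (𝓞 F) F)
          (Matrix.fromBlocks
            (TV.map (algebraMap F (AdeleRing (𝓞 F) F)) ⊗ₖ T₁.map (algebraMap F (AdeleRing (𝓞 F) F))) 0 0
            (TV.map (algebraMap F (AdeleRing (𝓞 F) F)) ⊗ₖ T₂.map (algebraMap F (AdeleRing (𝓞 F) F))))))) :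
        (((Fin N × Fin M₁) ⊕ (Fin N × Fin M₂) → AdeleRing (𝓞 F) F) ×
            ((Fin N × Fin M₁) ⊕ (Fin N × Fin M₂) → AdeleRing (𝓞 F) F)) ≃ₗ[AdeleRing (𝓞 F) F]
          (((Fin N × Fin M₁) ⊕ (Fin N × Fin M₂) → AdeleRing (𝓞 F) F) ×
            ((Fin N × Fin M₁) ⊕ (Fin N × Fin M₂) → AdeleRing (𝓞 F) F))) := by
  rw [eq_of_conj_symplecticGroupCongr_eq _ _ _ _ _
    (hx.trans (adelicSeesawConj_conj_adelicBlockDiag F E c N M₁ M₂ hcδ hδ hd hV hW h₁ h₂ hJV hJW hJ₁ hJ₂ g hg C hC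
      v u).symm)]
  exact adelicPairToSymplectic_dualPair_adelicBlockDiag F E c N M₁ M₂ hcδ hδ hd hV h₁ h₂ hJV hJ₁ hJ₂ v u

/-- **`h₀` OF RATIONAL DATA IS `F`-RATIONAL, `T_W′ = T₁ ⊕ᶠ T₂`**: for `g = g₀ ⊗ 1`, `C = C₀ ⊗ 1` and
`det T_V, det T_W ≠ 0`, `adelicSeesawConj g C ∈ ((transportSp (T_V.map ι ⊗ₖ T_W.map ι) hT).comp (mapHom ι)).range`,
`ι = algebraMap F 𝔸_F` (`UnitaryGroupSeesawConjugation.adelicSeesawConj_mem_range` with `T_W′ = T₁ ⊕ᶠ T₂`; cf.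
[GelbartRogawski1991, §3.1 p. 455]). [folklore] -/
theorem adelicSeesawConj_finSum_mem_range [Algebra.IsQuadraticExtension F E] {δ : E} (hcδ : c δ = -δ) (hδ : δ ≠ 0)
    {d : F} (hd : δ * δ = algebraMap F E d) {TV : Matrix (Fin N) (Fin N) F}
    {TW : Matrix (Fin (M₁ + M₂)) (Fin (M₁ + M₂)) F} {T₁ : Matrix (Fin M₁) (Fin M₁) F}
    {T₂ : Matrix (Fin M₂) (Fin M₂) F} (hV : TV.IsSymm) (hW : TW.IsSymm) (h₁ : T₁.IsSymm) (h₂ : T₂.IsSymm)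
    (hTVd : IsUnit TV.det) (hTWd : IsUnit TW.det)
    (hT : IsUnit (TV.map (algebraMap F (AdeleRing (𝓞 F) F)) ⊗ₖ TW.map (algebraMap F (AdeleRing (𝓞 F) F))).det)
    {JV : Matrix (Fin N) (Fin N) E} {JW : Matrix (Fin (M₁ + M₂)) (Fin (M₁ + M₂)) E}
    {J₁ : Matrix (Fin M₁) (Fin M₁) E} {J₂ : Matrix (Fin M₂) (Fin M₂) E} (hJV : JV = TV.map (algebraMap F E))
    (hJW : JW = TW.map (algebraMap F E)) (hJ₁ : J₁ = T₁.map (algebraMap F E)) (hJ₂ : J₂ = T₂.map (algebraMap F E))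
    {g : GL (Fin (M₁ + M₂)) (AdeleRing (𝓞 E) E)} {g₀ : GL (Fin (M₁ + M₂)) E}
    (hgg₀ : (g : Matrix (Fin (M₁ + M₂)) (Fin (M₁ + M₂)) (AdeleRing (𝓞 E) E)) =
      ((g₀ : GL (Fin (M₁ + M₂)) E) : Matrix (Fin (M₁ + M₂)) (Fin (M₁ + M₂)) E).map
        (algebraMap E (AdeleRing (𝓞 E) E)))
    (hg : ((g : Matrix (Fin (M₁ + M₂)) (Fin (M₁ + M₂)) (AdeleRing (𝓞 E) E)).map (conjAdele F E c))ᵀ *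
        adelicForm E (M₁ + M₂) JW * g = adelicForm E (M₁ + M₂) (finSum M₁ M₂ J₁ J₂))
    {C : GL (Fin N × Fin (M₁ + M₂)) (AdeleRing (𝓞 F) F)} {C₀ : GL (Fin N × Fin (M₁ + M₂)) F}
    (hCC₀ : (C : Matrix (Fin N × Fin (M₁ + M₂)) (Fin N × Fin (M₁ + M₂)) (AdeleRing (𝓞 F) F)) =
      ((C₀ : GL (Fin N × Fin (M₁ + M₂)) F) : Matrix (Fin N × Fin (M₁ + M₂)) (Fin N × Fin (M₁ + M₂)) F).map
        (algebraMap F (AdeleRing (𝓞 F) F)))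
    (hC : TV.map (algebraMap F (AdeleRing (𝓞 F) F)) ⊗ₖ TW.map (algebraMap F (AdeleRing (𝓞 F) F)) *
        (C : Matrix (Fin N × Fin (M₁ + M₂)) (Fin N × Fin (M₁ + M₂)) (AdeleRing (𝓞 F) F)) =
      TV.map (algebraMap F (AdeleRing (𝓞 F) F)) ⊗ₖ (finSum M₁ M₂ T₁ T₂).map (algebraMap F (AdeleRing (𝓞 F) F))) :
    adelicSeesawConj F E c N (M₁ + M₂) hcδ hδ hd hV hW (isSymm_finSum h₁ h₂) hJV hJW (finSum_eq_map F E M₁ M₂ hJ₁ hJ₂)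
        g hg C hC ∈
      ((SymplecticMatrix.transportSp
          (TV.map (algebraMap F (AdeleRing (𝓞 F) F)) ⊗ₖ TW.map (algebraMap F (AdeleRing (𝓞 F) F))) hT).comp
        (SymplecticMatrix.mapHom (algebraMap F (AdeleRing (𝓞 F) F)))).range :=
  adelicSeesawConj_mem_range F E c N (M₁ + M₂) hcδ hδ hd hV hW _ hTVd hTWd hT hJV hJW _ hgg₀ hg hCC₀ hC

end DualPairAdelic

end UnitaryGroup

end Literature.NumberTheory.Automorphic

end
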